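import Mathlib.RingTheory.DedekindDomain.Different
import Mathlib.NumberTheory.NumberField.Discriminant.Different
import Literature.NumberTheory.Automorphic.GlobalAdditiveCharacter
import Literature.NumberTheory.Automorphic.WhittakerCoeffLocalDatum
import HarnessLib

/-!
# The standard character `ψ_K` is unramified at every finite place not dividing the different

Topic `NumberTheory/Automorphic`; namespace `Literature.NumberTheory.Automorphic`. For Tate's global
additive character `ψ_K = adeleAddChar K` of `𝔸_K` (`AdelicAdditiveCharacter`) and a finite place
`v` of the number field `K`, the local component `ψ_v = ψ_K ∘ ι_v` (`AddChar.adicComponent`,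
`GlobalAdditiveCharacter`) is trivial on `𝒪_v` for **every** `v` (tree:
`adeleAddCharAt_eq_one_of_mem`), and — the content of this file — **non-trivial on `𝔭_v⁻¹ 𝒪_v`
whenever `v` does not divide the different `𝔡_{K/ℚ}`**, hence for all but finitely many `v`
(Tate (1950), Lemma 2.2.3: `ψ_𝔭` is trivial on `η 𝒪_𝔭` iff `η ∈ 𝔡_𝔭⁻¹`; §4.1: `𝔡_𝔭 = 𝒪_𝔭` for
almost all `𝔭`). This discharges, for the places `v ∤ 𝔡`, the "unramified almost everywhere" half of
the named fact `Tate1950_adicComponent_adeleAddChar` of `GlobalAdditiveCharacter`, in exactly the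
currency consumed by Shintani's formula for global Whittaker coefficients
(`whittakerCoeff_smoothedForm_ofLocal_piPowGL_eq` of `WhittakerCoeffCuspidal`: hypotheses
`hψv`, `hψv'`).

Proof. If `𝔭 = v ∤ 𝔡` then `𝔭⁻¹ ⊄ 𝔡⁻¹ = (𝓞_K)^∨` (the codifferent, Mathlib `FractionalIdeal.dual ℤ ℚ 1`
with `coeIdeal_differentIdeal`), so some `k ∈ 𝔭⁻¹` has `Tr_{K/ℚ}(k a) ∉ ℤ` for some `a ∈ 𝓞_K`;
replacing `k` by `k a ∈ 𝔭⁻¹` we get `k ∈ 𝔭⁻¹` with `Tr_{K/ℚ}(k) ∉ ℤ`. Such `k` is integral at every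
`w ≠ v` and has `|k|_v ≤ |ϖ_v|⁻¹`, so by the global approximation formula
`ψ_v(x) = exp(2πi Tr_{K/ℚ}(k))` for `x ≡ k (mod 𝒪_v)` (`adeleAddCharAt_eq_of_sub_mem`) the element
`k_v ∈ ϖ_v⁻¹ 𝒪_v` has `ψ_v(k_v) ≠ 1`.

## Main statements (all proved)

* `exists_mem_inv_coeIdeal_trace_not_int` — `v ∤ 𝔡 ⟹ ∃ k ∈ 𝔭_v⁻¹, Tr_{K/ℚ}(k) ∉ ℤ`;
* `valuation_le_of_mem_inv_coeIdeal`, `valuation_le_one_of_mem_inv_coeIdeal_of_ne` — local size of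
  the elements of `𝔭_v⁻¹`;
* `adicComponent_adeleAddChar_apply_ne_one` — `v ∤ 𝔡 ⟹ ∃ x, |x|_v ≤ exp 1 ∧ ψ_v(x) ≠ 1`;
* `adicComponent_adeleAddChar_unramified` — for `v ∤ 𝔡`: `ψ_v` is trivial on the valuation ring
  `𝒪[K_v]` and for every uniformizer `ϖ` (`|ϖ|_v = exp(-1)`) some `c ∈ 𝒪[K_v]` has
  `ψ_v(ϖ⁻¹ c) ≠ 1` (the `ValuativeRel` language of the local Whittaker files);
* `finite_setOf_dvd_differentIdeal`, `exists_finset_adicComponent_adeleAddChar_unramified` — off a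
  finite set of places `ψ_v` is unramified in this sense.

## References

* J. Tate, *Fourier analysis in number fields and Hecke's zeta-functions* (1950), in Cassels–Fröhlich
  (1967), Ch. XV: Lemma 2.2.3, §4.1 [CasselsFrohlichANT1967].
* J. Neukirch, *Algebraic Number Theory*, Ch. III §2 (the different and the codifferent
  `𝔡⁻¹ = {x | Tr(x 𝓞) ⊆ ℤ}`, (2.1)–(2.2)).
-/

noncomputable section

namespace Literature.NumberTheory.Automorphic

open NumberField IsDedekindDomain
open scoped nonZeroDivisors

variable (K : Type) [Field K] [NumberField K]

/-! ### Elements of `𝔭⁻¹` with non-integral trace -/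

section Different

variable {K}

/-- **`v ∤ 𝔡 ⟹ 𝔭_v⁻¹` contains an element of non-integral trace.** If the finite place `v` does
not divide the different `𝔡 = differentIdeal ℤ (𝓞 K)`, there is `k ∈ 𝔭_v⁻¹` (inverse of `v` as a
fractional ideal) with `Tr_{K/ℚ}(k) ∉ ℤ`: otherwise `𝔭_v⁻¹ 𝓞_K = 𝔭_v⁻¹` would lie in the codifferent
`𝔡⁻¹ = (𝓞_K)^∨` (Mathlib `FractionalIdeal.dual`, `coeIdeal_differentIdeal`), i.e. `𝔡 ⊆ 𝔭_v`
(Neukirch III (2.2); Tate (1950), Lemma 2.2.3). [folklore] -/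
theorem exists_mem_inv_coeIdeal_trace_not_int {v : HeightOneSpectrum (𝓞 K)}
    (hv : ¬ v.asIdeal ∣ differentIdeal ℤ (𝓞 K)) :
    ∃ k : K, k ∈ ((v.asIdeal : FractionalIdeal (𝓞 K)⁰ K))⁻¹ ∧
      Algebra.trace ℚ K k ∉ (algebraMap ℤ ℚ).range := by
  classical
  set P : FractionalIdeal (𝓞 K)⁰ K := (v.asIdeal : FractionalIdeal (𝓞 K)⁰ K) with hP
  set D : FractionalIdeal (𝓞 K)⁰ K :=
    ((differentIdeal ℤ (𝓞 K) : Ideal (𝓞 K)) : FractionalIdeal (𝓞 K)⁰ K) with hD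
  have hP0 : P ≠ 0 := FractionalIdeal.coeIdeal_ne_zero.2 v.ne_bot
  have hD0 : D ≠ 0 := by
    rw [hD, FractionalIdeal.coeIdeal_ne_zero]
    intro h
    have := _root_.NumberField.absNorm_differentIdeal K (𝓞 K)
    rw [h, Ideal.absNorm_bot] at this
    exact (Int.natAbs_ne_zero.2 (NumberField.discr_ne_zero K)) this.symm
  have hdual : FractionalIdeal.dual ℤ ℚ (1 : FractionalIdeal (𝓞 K)⁰ K) = D⁻¹ := by
    rw [hD, coeIdeal_differentIdeal ℤ ℚ K, inv_inv]
  -- `P⁻¹` is not contained in the codifferent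
  have hnot : ¬ P⁻¹ ≤ FractionalIdeal.dual ℤ ℚ (1 : FractionalIdeal (𝓞 K)⁰ K) := by
    intro hle
    rw [hdual] at hle
    -- `D ≤ P`
    have hDP : D ≤ P := by
      have h1 : D * P⁻¹ ≤ D * D⁻¹ := mul_le_mul_right hle D
      rw [mul_inv_cancel₀ hD0] at h1
      calc D = D * P⁻¹ * P := by rw [mul_assoc, inv_mul_cancel₀ hP0, mul_one]
        _ ≤ 1 * P := mul_le_mul_left h1 P
        _ = P := one_mul P
    rw [hD, hP, FractionalIdeal.coeIdeal_le_coeIdeal] at hDP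
    exact hv (Ideal.dvd_iff_le.2 hDP)
  -- extract the element
  obtain ⟨k, hkP, hk⟩ := SetLike.not_le_iff_exists.1 hnot
  rw [FractionalIdeal.mem_dual (one_ne_zero' (FractionalIdeal (𝓞 K)⁰ K))] at hk
  push Not at hk
  obtain ⟨a, ha, hka⟩ := hk
  refine ⟨k * a, ?_, ?_⟩
  · have : k * a ∈ P⁻¹ * 1 := FractionalIdeal.mul_mem_mul hkP ha
    rwa [mul_one] at this
  · rwa [Algebra.traceForm_apply] at hka

/-- Elements of `𝔭_v⁻¹` are integral at every finite place `w ≠ v`. [folklore] -/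
theorem valuation_le_one_of_mem_inv_coeIdeal_of_ne {v w : HeightOneSpectrum (𝓞 K)} (hw : w ≠ v)
    {k : K} (hk : k ∈ ((v.asIdeal : FractionalIdeal (𝓞 K)⁰ K))⁻¹) : w.valuation K k ≤ 1 := by
  classical
  have hP0 : (v.asIdeal : FractionalIdeal (𝓞 K)⁰ K) ≠ 0 := FractionalIdeal.coeIdeal_ne_zero.2 v.ne_bot
  rw [FractionalIdeal.mem_inv_iff hP0] at hk
  -- an element of `v` outside `w`
  have hne : ¬ v.asIdeal ≤ w.asIdeal := fun h =>
    hw (HeightOneSpectrum.ext (v.isMaximal.eq_of_le w.isPrime.ne_top h)).symm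
  obtain ⟨y, hyv, hyw⟩ := Set.not_subset.1 hne
  have hy1 : w.valuation K (algebraMap (𝓞 K) K y) = 1 := by
    rw [HeightOneSpectrum.valuation_of_algebraMap]
    exact le_antisymm (w.intValuation_le_one y)
      (not_lt.1 fun h => hyw ((w.intValuation_lt_one_iff_mem y).1 h))
  have hky : k * algebraMap (𝓞 K) K y ∈ (1 : FractionalIdeal (𝓞 K)⁰ K) :=
    hk _ (FractionalIdeal.mem_coeIdeal_of_mem _ hyv)
  obtain ⟨z, hz⟩ := (FractionalIdeal.mem_one_iff (𝓞 K)⁰).1 hky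
  have hval : w.valuation K (k * algebraMap (𝓞 K) K y) ≤ 1 := by
    rw [← hz, HeightOneSpectrum.valuation_of_algebraMap]
    exact w.intValuation_le_one z
  rwa [map_mul, hy1, mul_one] at hval

/-- Elements of `𝔭_v⁻¹` have `|k|_v ≤ exp 1` (one pole at most at `v`). [folklore] -/
theorem valuation_le_exp_one_of_mem_inv_coeIdeal {v : HeightOneSpectrum (𝓞 K)} {k : K}
    (hk : k ∈ ((v.asIdeal : FractionalIdeal (𝓞 K)⁰ K))⁻¹) :
    v.valuation K k ≤ WithZero.exp (1 : ℤ) := by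
  classical
  have hP0 : (v.asIdeal : FractionalIdeal (𝓞 K)⁰ K) ≠ 0 := FractionalIdeal.coeIdeal_ne_zero.2 v.ne_bot
  rw [FractionalIdeal.mem_inv_iff hP0] at hk
  obtain ⟨π, hπ⟩ := v.intValuation_exists_uniformizer
  have hπv : π ∈ v.asIdeal := by
    rw [← v.intValuation_lt_one_iff_mem, hπ, ← WithZero.exp_zero, WithZero.exp_lt_exp]
    norm_num
  have hkπ : k * algebraMap (𝓞 K) K π ∈ (1 : FractionalIdeal (𝓞 K)⁰ K) :=
    hk _ (FractionalIdeal.mem_coeIdeal_of_mem _ hπv)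
  obtain ⟨z, hz⟩ := (FractionalIdeal.mem_one_iff (𝓞 K)⁰).1 hkπ
  have hval : v.valuation K (k * algebraMap (𝓞 K) K π) ≤ 1 := by
    rw [← hz, HeightOneSpectrum.valuation_of_algebraMap]
    exact v.intValuation_le_one z
  rw [map_mul, HeightOneSpectrum.valuation_of_algebraMap, hπ] at hval
  have h0 : WithZero.exp (-1 : ℤ) ≠ 0 := WithZero.exp_ne_zero
  calc v.valuation K k = v.valuation K k * WithZero.exp (-1 : ℤ) * WithZero.exp (1 : ℤ) := by
        rw [mul_assoc, ← WithZero.exp_add, neg_add_cancel, WithZero.exp_zero, mul_one]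
    _ ≤ 1 * WithZero.exp (1 : ℤ) := mul_le_mul_left hval _
    _ = WithZero.exp (1 : ℤ) := one_mul _

end Different

/-! ### Non-triviality of `ψ_v` on `𝔭_v⁻¹` for `v ∤ 𝔡` -/

section Character

variable {K}

/-- **`ψ_v` is non-trivial on `𝔭_v⁻¹ 𝒪_v` for `v ∤ 𝔡`** (Tate (1950), Lemma 2.2.3 with §4.1): there
is `x ∈ K_v` with `|x|_v ≤ exp 1` and `ψ_v(x) ≠ 1`, namely the image of a global `k ∈ 𝔭_v⁻¹` with
`Tr_{K/ℚ}(k) ∉ ℤ`, for which `ψ_v(k) = exp(2πi Tr_{K/ℚ}(k))` (`adeleAddCharAt_eq_of_sub_mem`).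
[cite: CasselsFrohlichANT1967, Ch. XV (Tate), Lemma 2.2.3] -/
theorem adicComponent_adeleAddChar_apply_ne_one {v : HeightOneSpectrum (𝓞 K)}
    (hv : ¬ v.asIdeal ∣ differentIdeal ℤ (𝓞 K)) :
    ∃ x : v.adicCompletion K, Valued.v x ≤ WithZero.exp (1 : ℤ) ∧
      (adeleAddChar K).adicComponent v x ≠ 1 := by
  obtain ⟨k, hk, htr⟩ := exists_mem_inv_coeIdeal_trace_not_int hv
  refine ⟨(k : v.adicCompletion K), ?_, ?_⟩
  · rw [HeightOneSpectrum.valuedAdicCompletion_eq_valuation']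
    exact valuation_le_exp_one_of_mem_inv_coeIdeal hk
  · have hsub : (k : v.adicCompletion K) - (k : v.adicCompletion K) ∈ v.adicCompletionIntegers K := by
      rw [sub_self]; exact zero_mem _
    have hw : ∀ w : HeightOneSpectrum (𝓞 K), w ≠ v →
        (k : w.adicCompletion K) ∈ w.adicCompletionIntegers K := fun w hw => by
      rw [HeightOneSpectrum.mem_adicCompletionIntegers,
        HeightOneSpectrum.valuedAdicCompletion_eq_valuation']
      exact valuation_le_one_of_mem_inv_coeIdeal_of_ne hw hk
    rw [show (adeleAddChar K).adicComponent v = adeleAddCharAt K v from rfl,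
      adeleAddCharAt_eq_of_sub_mem K v hsub hw]
    intro h
    have h0 : ((((Algebra.trace ℚ K k : ℚ) : ℝ) : AddCircle (1 : ℝ))) = 0 :=
      AddCircle.injective_toCircle one_ne_zero (by rw [h, AddCircle.toCircle_zero])
    rw [AddCircle.coe_eq_zero_iff] at h0
    obtain ⟨n, hn⟩ := h0
    refine htr ⟨n, ?_⟩
    have : ((n : ℚ) : ℝ) = ((Algebra.trace ℚ K k : ℚ) : ℝ) := by
      rw [← hn, zsmul_eq_mul, mul_one, Rat.cast_intCast]
    exact_mod_cast this

open ValuativeRel in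
/-- **`ψ_v` has conductor `𝒪_v` for `v ∤ 𝔡`, in the language of the local Whittaker files**: the local
component of Tate's character is trivial on the valuation ring `𝒪[K_v]` (every `v`;
`adeleAddCharAt_eq_one_of_mem`) and, for `v ∤ 𝔡` and every `ϖ` with `|ϖ|_v = exp(-1)`, non-trivial at
some `ϖ⁻¹ c`, `c ∈ 𝒪[K_v]` — the hypotheses `hψv`, `hψv'` of
`whittakerCoeff_smoothedForm_ofLocal_piPowGL_eq` (`WhittakerCoeffCuspidal`) for `ψ = ψ_K`.
[cite: CasselsFrohlichANT1967, Ch. XV (Tate), Lemma 2.2.3 and §4.1] -/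
theorem adicComponent_adeleAddChar_unramified {v : HeightOneSpectrum (𝓞 K)}
    (hv : ¬ v.asIdeal ∣ differentIdeal ℤ (𝓞 K)) :
    (∀ c ∈ 𝒪[v.adicCompletion K], (adeleAddChar K).adicComponent v c = 1) ∧
      ∀ ϖ : v.adicCompletion K, Valued.v ϖ = WithZero.exp (-1 : ℤ) →
        ∃ c ∈ 𝒪[v.adicCompletion K], (adeleAddChar K).adicComponent v (ϖ⁻¹ * c) ≠ 1 := by
  refine ⟨fun c hc => ?_, fun ϖ hϖ => ?_⟩
  · exact adeleAddCharAt_eq_one_of_mem K v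
      ((HeightOneSpectrum.mem_adicCompletionIntegers _ _ _).2
        ((mem_integer_adicCompletion_iff K v).1 hc))
  · obtain ⟨x, hx, hne⟩ := adicComponent_adeleAddChar_apply_ne_one hv
    have hϖ0 : ϖ ≠ 0 := by
      intro h; rw [h, map_zero] at hϖ; exact WithZero.exp_ne_zero hϖ.symm
    refine ⟨ϖ * x, ?_, by rwa [← mul_assoc, inv_mul_cancel₀ hϖ0, one_mul]⟩
    rw [mem_integer_adicCompletion_iff, map_mul, hϖ]
    calc WithZero.exp (-1 : ℤ) * Valued.v x ≤ WithZero.exp (-1 : ℤ) * WithZero.exp (1 : ℤ) :=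
          mul_le_mul_right hx _
      _ = 1 := by rw [← WithZero.exp_add, neg_add_cancel, WithZero.exp_zero]

/-- The set of finite places dividing the different is finite (`𝔡 ≠ 0`, since `N(𝔡) = |d_K| ≠ 0`,
Mathlib `NumberField.absNorm_differentIdeal`; finitely many prime factors,
`Ideal.finite_factors`). [folklore] -/
theorem finite_setOf_dvd_differentIdeal :
    {v : HeightOneSpectrum (𝓞 K) | v.asIdeal ∣ differentIdeal ℤ (𝓞 K)}.Finite := by
  have hD0 : differentIdeal ℤ (𝓞 K) ≠ ⊥ := by
    intro h
    have := _root_.NumberField.absNorm_differentIdeal K (𝓞 K)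
    rw [h, Ideal.absNorm_bot] at this
    exact (Int.natAbs_ne_zero.2 (NumberField.discr_ne_zero K)) this.symm
  exact Ideal.finite_factors hD0

open ValuativeRel in
/-- **Off a finite set of places, `ψ_K` is unramified**: there is a finite set `S₀` of finite places
such that for every `v ∉ S₀` the local component `(ψ_K)_v` is trivial on `𝒪[K_v]` and, for every
uniformizer, non-trivial at some `ϖ⁻¹ c`, `c ∈ 𝒪[K_v]` (Tate (1950), §4.1: "`𝔡_𝔭 = 𝒪_𝔭` for almost
all `𝔭`"). This is the part of the named fact `Tate1950_adicComponent_adeleAddChar` of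
`GlobalAdditiveCharacter` needed by the unramified Whittaker computations, proved.
[cite: CasselsFrohlichANT1967, Ch. XV (Tate), §4.1] -/
theorem exists_finset_adicComponent_adeleAddChar_unramified :
    ∃ S₀ : Finset (HeightOneSpectrum (𝓞 K)), ∀ v ∉ S₀,
      (∀ c ∈ 𝒪[v.adicCompletion K], (adeleAddChar K).adicComponent v c = 1) ∧
        ∀ ϖ : v.adicCompletion K, Valued.v ϖ = WithZero.exp (-1 : ℤ) →
          ∃ c ∈ 𝒪[v.adicCompletion K], (adeleAddChar K).adicComponent v (ϖ⁻¹ * c) ≠ 1 := by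
  refine ⟨(finite_setOf_dvd_differentIdeal (K := K)).toFinset, fun v hv => ?_⟩
  rw [Set.Finite.mem_toFinset, Set.mem_setOf_eq] at hv
  exact adicComponent_adeleAddChar_unramified hv

end Character

end Literature.NumberTheory.Automorphic
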